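import Summits.BirchSwinnertonDyer.Rank1Residual.JET.RingClassTransverseCount
import Summits.BirchSwinnertonDyer.Rank1Residual.X11b.KummerRelaxedStructures
import Summits.BirchSwinnertonDyer.Rank1Residual.X11b.MaxUnramifiedRestriction
import HarnessLib

/-!
# `H¹_f(K_λ, E[p^k]) ∩ H¹_tr(K_λ, E[p^k]) = 0` at the prime `λ` of `K` over a Kolyvagin prime `ℓ` — the
# supply's closed statement `htrf` ([J] §4.2 = [MR04] Lemma 1.2.4) is a THEOREM on the frame
# (cell `bsd-stepL`, seat `bsd-stepL-tam3-p1`, helper toward item 19109 `EulerHalvesAtThree`)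

HONEST FRAMING. Nothing here proves BSD, J₃ or any divisibility of a Heegner point; no stub is
discharged; no item closes; 0 classes move (T7); `--supports stmt-BirchSwinnertonDyer-19109` (helper).

WHAT THIS FILE DOES. `disjoint_kummer_iInf_transverseSubgroup`: for `K` imaginary quadratic with
`d_K < −4`, a Kolyvagin prime `ℓ` (Zhang currency) and the place `v ∋ ℓ`: the Kummer condition
`Kum_v ≤ H¹(K_v, E[p^k])` and the intrinsic transverse condition `⨅_{w' ∣ v} ker(H¹(K_v, E[p^k]) →
H¹(K[ℓ]_{w'}, E[p^k]))` are DISJOINT. Proof (Mazur–Rubin Lemma 1.2.4): at the good place `v ∤ p` the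
Kummer condition is the unramified one (`kummerSelmerStructure_inr_eq_unramifiedSubgroup`), i.e. the
classes principal on the inertia group `I_v` (`LocBridge.mem_unramifiedSubgroup_one_iff_exists`), which
acts trivially on `E[p^k]` (`toLocal_apply_eq_of_mem_absInertia`); a transverse class is principal on
`range(Γ_{K[ℓ]_{w'}} → Γ_{K_v}) = ker Φ` for bsd-jet ty's ring class character `Φ`
(`exists_ringClassCharacter`, `ringClassCharacter_eq_one_iff_mem_range`), every value of which is
attained on inertia, so `Γ_{K_v} = I_v · ker Φ`; a cocycle vanishing on `I_v` and principal on `ker Φ` is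
principal (`φ(th) = φ t + t φ h`). With this file the hypothesis `htrf` of
`Koly.selmerSupplyAtThree_of_gaps` is dischargeable on every frame of the supply (`d_K` odd, `3 ∣ N`
split ⇒ `d_K < −4`). References (locators only; no cited FACT is declared): [cite: Jetchev2008, §4.2
(p. 818), §3.1.2] [cite: MazurRubin2004, Lemma 1.2.4, Def. 1.1.6] [cite: Rubin2011, Prop. 1.9.5]
[cite: MilneADT2006, Ch. I §2, Prop. 3.8] [cite: SilvermanAEC2009, Cor. X.4.4]. Design: no definitions;
`K : Type`. Axioms: `propext`, `Classical.choice`, `Quot.sound`.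
-/

set_option autoImplicit false

noncomputable section

open scoped Classical Pointwise
open CategoryTheory ContinuousCohomology WeierstrassCurve Field Function NumberField IsDedekindDomain
open Literature.NumberTheory.EllipticCurves
open Literature.NumberTheory.GaloisRepresentations Literature.NumberTheory.GaloisCohomology
open Literature.NumberTheory.GaloisRepresentations.DiscreteGaloisModule (transverseSubgroup SelmerStructure
  unramifiedSubgroup)
open Literature.NumberTheory.Automorphic _root_.TopRep
open Summit.BirchSwinnertonDyer.Rank1Residual.X11b
open Summit.BirchSwinnertonDyer.Rank1Residual.JET.RingClassTransverse

namespace Summit.BirchSwinnertonDyer.Rank1Residual.JET.Walk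

variable (W : WeierstrassCurve ℚ) [W.IsElliptic] [W.IsGloballyMinimal] (K : Type) [Field K] [NumberField K]

/-- **[J] §4.2 / [MR04] Lemma 1.2.4: `H¹_f(K_λ) ∩ H¹_tr(K_λ) = 0` at a Kolyvagin prime** (see the module
docstring): the Kummer condition at the place `v ∋ ℓ` is disjoint from the intrinsic `K[ℓ]`-transverse
condition. [cite: Jetchev2008, §4.2 (p. 818)] [cite: MazurRubin2004, Lemma 1.2.4]
[cite: MilneADT2006, Ch. I Prop. 3.8] -/
theorem disjoint_kummer_iInf_transverseSubgroup (hK : IsImaginaryQuadratic K)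
    (hD : NumberField.discr K < -4) (ι : K →+* ℂ) [∀ j : ℕ, NumberField (ringClassField K ι j)]
    {p : ℕ} [hp : Fact p.Prime] (k : ℕ)
    {ℓ : ℕ} (hℓ : Zhang2014.IsKolyvaginPrime (W.conductorNorm ℤ) W K p ℓ)
    (v : HeightOneSpectrum (𝓞 K)) (hv : (ℓ : 𝓞 K) ∈ v.asIdeal) :
    Disjoint ((W.baseChange K).kummerSelmerStructure ((p ^ k : ℕ) : ℤ) (Sum.inr v))
      (⨅ (w' : HeightOneSpectrum (𝓞 (ringClassField K ι ℓ))) (_ : w'.asIdeal.LiesOver v.asIdeal),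
        letI := (adicCompletionOfLiesOver K (ringClassField K ι ℓ) v w').toAlgebra
        transverseSubgroup (GaloisRep.toLocal v ((W.baseChange K).torsionGaloisModule ((p ^ k : ℕ) : ℤ)))
          (w'.adicCompletion (ringClassField K ι ℓ))) := by
  have hℓp : ℓ.Prime := hℓ.1
  have hℓP : (Ideal.span {(ℓ : 𝓞 K)}).IsPrime := hℓ.2.2.2.2.1
  have hℓ0 : ℓ ≠ 0 := hℓp.ne_zero
  haveI := (finiteDimensional_and_isGalois_ringClassField hK ι hℓ0).1
  haveI := (finiteDimensional_and_isGalois_ringClassField hK ι hℓ0).2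
  let ρv := GaloisRep.toLocal v ((W.baseChange K).torsionGaloisModule ((p ^ k : ℕ) : ℤ))
  -- `v` is a good place prime to `p`: the Kummer condition is the unramified one
  obtain ⟨hgood, hp1⟩ := hasGoodReductionAt_of_zhangKolyvagin W K hp.out hℓ v hv 1
  have hpv : ((p : ℕ) : 𝓞 K) ∉ v.asIdeal := by
    intro h; apply hp1; rw [pow_one, Int.cast_natCast]; exact h
  have hKum : (W.baseChange K).kummerSelmerStructure ((p ^ k : ℕ) : ℤ) (Sum.inr v) =
      unramifiedSubgroup ρv 1 :=
    KummerPT.kummerSelmerStructure_inr_eq_unramifiedSubgroup (W.baseChange K) p k hpv hgood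
  -- inertia acts trivially on `E[p^k]`
  have hI := toLocal_apply_eq_of_mem_absInertia W K hp.out hℓ v hv k
  -- a place `w₀ ∣ v` of `K[ℓ]` and the ring class character
  obtain ⟨w₀⟩ := (inferInstance : Nonempty (SemiLocal.Place K (ringClassField K ι ℓ) v))
  haveI hw₀ : (w₀ : HeightOneSpectrum (𝓞 (ringClassField K ι ℓ))).asIdeal.LiesOver v.asIdeal :=
    SemiLocal.Place.liesOver w₀
  let e₀ : ringClassField K ι ℓ →ₐ[K] AlgebraicClosure K := IsAlgClosed.lift
  obtain ⟨Φ, hker, hΦI, -, -, -⟩ := exists_ringClassCharacter K hK hD ι hℓp hℓP v hv e₀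
  -- (the place-indexed completion `Place.Completion (Sum.inr v)` is `K_v`, not reducibly)
  haveI : IsTopologicalGroup (absoluteGaloisGroup (Place.Completion (Sum.inr v : Place K))) :=
    inferInstanceAs (IsTopologicalGroup (absoluteGaloisGroup (v.adicCompletion K)))
  rw [AddSubgroup.disjoint_def]
  intro x hxK hxT
  obtain ⟨φ, hφ⟩ : ∃ φ : contOneCocycles ρv.toTopRep, oneCocycleClass ρv.toTopRep φ = x :=
    oneCocycleClass_surjective ρv.toTopRep _
  subst hφ
  -- unramified: `φ` vanishes on inertia
  rw [hKum] at hxK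
  obtain ⟨w, hw⟩ := (LocBridge.mem_unramifiedSubgroup_one_iff_exists ρv φ).mp hxK
  have hφI : ∀ t ∈ absInertia (v.adicCompletion K), φ.1 t = 0 := fun t ht ↦ by
    rw [hw t ht]
    change ρv t w - w = 0
    rw [hI t ht w, sub_self]
  -- transverse at `w₀`: `φ` is principal on `ker Φ`
  have hxw₀ := (AddSubgroup.mem_iInf.mp ((AddSubgroup.mem_iInf.mp hxT) (w₀ : HeightOneSpectrum _))) hw₀
  letI := (adicCompletionOfLiesOver K (ringClassField K ι ℓ) v
    (w₀ : HeightOneSpectrum (𝓞 (ringClassField K ι ℓ)))).toAlgebra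
  obtain ⟨m₀, hm₀⟩ := (mem_transverseSubgroup_iff_exists_forall_range ρv _ φ).mp hxw₀
  have hm₀' : ∀ h, Φ h = 1 → φ.1 h = ρv h m₀ - m₀ := fun h hh ↦
    hm₀ h ((ringClassCharacter_eq_one_iff_mem_range K hK ι hℓ0 v e₀ Φ hker _ h).mp hh)
  -- `Γ = I · ker Φ`: `φ` is principal
  refine (oneCocycleClass_eq_zero_iff ρv.toTopRep φ).mpr ⟨m₀, fun g ↦ ?_⟩
  obtain ⟨t, ht, htg⟩ := hΦI g
  have hh : Φ (t⁻¹ * g) = 1 := by rw [map_mul, map_inv, htg, inv_mul_cancel]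
  have hcoc := φ.2 t (t⁻¹ * g)
  rw [mul_inv_cancel_left] at hcoc
  rw [hcoc, hφI t ht, zero_add, hm₀' _ hh]
  change ρv t (ρv (t⁻¹ * g) m₀ - m₀) = ρv g m₀ - m₀
  rw [map_sub, hI t ht m₀, ← Module.End.mul_apply, ← map_mul, mul_inv_cancel_left]

end Summit.BirchSwinnertonDyer.Rank1Residual.JET.Walk

end
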